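import Summits.AtomisticToContinuum.HydrodynamicLimit.Theorems.RelayRaceLocalityNearConstantShortTimeHLHLDefs
import HarnessLib

/-!
# Crux `NearConstantShortTimeHL` (stmt-AtomisticToContinuum-12502), line `small-tilt-domination` (lead c10, cycle 2, "HL project"):
# `stub_entropyToLLNHL : RelEntropyHL → ShortTimeHLGeneral` — entropy ⇒ LLN at `t` in the sub-problem frame

Support file (`--supports stmt-AtomisticToContinuum-12502`). The sub-problem frame of the line (`…HLDefs`: `∃ η₀ > 0 ∀`
continuous positive profiles `∃ σ₀ > 0 ∀ σ ∈ (0, σ₀) ∀` admissible general families `(ε_N > 0, ε_N → 0, n_N ε_N³ → σ³) ∀`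
classical hs-Euler solutions on `[0, T)` `∀` flows, canonical local Gibbs laws `P_N` probability measures tied to the Euler
data by the LLN at `t = 0`, `∀ t ∈ [0, T)` under the packing guard `ρ σ³ < η₀` on `[0, t]` — no `M`, no `δ₀`, no `τ₀`, no
near-constancy) carries the LAST step of Yau's relative-entropy method exactly as the crux's frame does
(`stub_entropyToLLN : NearConstantRelEntropy → NearConstantShortTimeHL`, `…EntropyToLLN`): the Yau-form target `RelEntropyHL`
(finite reference laws `Q_N` at time `t` whose empirical density / momentum / energy fields concentrate exponentially in `n_N`,
`≤ C e^{-n_N/C}`, and `KL((Φ_N t)_* P_N ‖ Q_N)/n_N → 0`) implies the LLN of the three empirical fields at time `t`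
(`ShortTimeHLGeneral`).

PROOF (the template `stub_entropyToLLN` with the frame plumbing shortened). (1) The particle number of an admissible family
diverges, `n_N → ∞` (`tendsto_atTop_of_tendsto_mul_pow_three`). (2) The sequence form of the entropy inequality for events with
the size parameter `n_N` (`tendsto_measure_of_klDiv_div_natCast_tendsto_zero`): `ν_N(A_N) ≤ C e^{-n_N/C}` and
`KL(μ_N ‖ ν_N)/n_N → 0` give `μ_N(A_N) → 0`, applied to `μ_N := (Φ_N t)_* P_N`, `ν_N := Q_N` and the three deviation events.
(3) The flow enters only through `P_N{z | Φ_N t z ∈ A} ≤ ((Φ_N t)_* P_N)(A)` (`HardSphereFlow.lawAt_eq`, `Measure.le_map_apply`,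
`HardSphereFlow.measurable_flow`; no measurability of the deviation events is needed; `(Φ_N t)_* P_N` is finite because `P_N` is
a probability measure by hypothesis). (4) The prefix is threaded with the SAME witnesses (`η₀`; `σ₀` for each profile).

References: H.-T. Yau, Lett. Math. Phys. 22 (1991) §2; C. Kipnis – C. Landim, *Scaling Limits of Interacting Particle Systems*
(1999), Ch. 6 §1; S. Olla – S.R.S. Varadhan – H.-T. Yau, Comm. Math. Phys. 155 (1993) §3.
Not here: any other statement of the HL pass (`stub_meansPinHL`, `stub_reductionHL`, `stub_dynamicHL`, `stub_goodEventPackageHL`,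
`hydrodynamicLimit_of_shortTimeHLGeneral`, `hydrodynamicLimit_of_trueLaw`).
-/

noncomputable section

namespace Summit.AtomisticToContinuum.HydrodynamicLimit.Theorems.NearConstantShortTimeHL

open scoped BigOperators ENNReal Topology
open MeasureTheory Set Filter InformationTheory
open Literature.MathematicalPhysics.KineticTheory Literature.Analysis.FluidPDE Literature.Analysis.FunctionSpaces

/-- **Entropy inequality ⇒ LLN at `t`, general data and families, sub-problem frame** (registered stub `stub_entropyToLLNHL`
of the HL pass): `RelEntropyHL → ShortTimeHLGeneral`. The prefix of the frame is threaded with the same witnesses; at the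
innermost point, for a fixed family `(ε_N, n_N)`, Euler solution, flows `Φ_N`, time `t`, test function `χ` and `δ > 0`, the
reference laws `Q_N` concentrate exponentially in `n_N` and `KL((Φ_N t)_* P_N ‖ Q_N)/n_N → 0` with `n_N → ∞`
(`tendsto_atTop_of_tendsto_mul_pow_three`), so `((Φ_N t)_* P_N)(deviation at t) → 0`
(`tendsto_measure_of_klDiv_div_natCast_tendsto_zero`), and `P_N{z | Φ_N t z deviates} ≤ ((Φ_N t)_* P_N){deviates}`
(`HardSphereFlow.lawAt_eq`, `Measure.le_map_apply`, `HardSphereFlow.measurable_flow`). [cite: Yau1991, §2]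
[cite: KipnisLandim1999, Ch. 6 §1] -/
theorem stub_entropyToLLNHL : RelEntropyHL → ShortTimeHLGeneral := by
  rintro ⟨η₀, hη₀, H⟩
  refine ⟨η₀, hη₀, fun a₀ θ₀ u₀ ha hθ hu ha0 hθ0 => ?_⟩
  obtain ⟨σ₀, hσ₀, H2⟩ := H a₀ θ₀ u₀ ha hθ hu ha0 hθ0
  refine ⟨σ₀, hσ₀, ?_⟩
  intro σ hσ hσ' ε n hε hε0 hn T ρ θ u hE Φ P hP h0 t ht hg χ hχ δ hδ
  obtain ⟨Q, hQfin, hconc, hkl⟩ := H2 σ hσ hσ' ε n hε hε0 hn T ρ θ u hE Φ hP h0 t ht hg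
  obtain ⟨C, hC, hCN⟩ := hconc χ hχ δ hδ
  have hn_top : Tendsto n atTop atTop := tendsto_atTop_of_tendsto_mul_pow_three hσ hε hε0 hn
  -- the laws at time `t`, their finiteness, and the transfer inequality along the flow
  haveI : ∀ N, IsFiniteMeasure (Q N) := hQfin
  haveI : ∀ N, IsFiniteMeasure ((Φ N).lawAt (P N) t) := fun N => by
    haveI := hP N
    rw [HardSphereFlow.lawAt_eq]
    infer_instance
  have htransfer : ∀ (N : ℕ) (A : Set (Config (n N) (Fin 3) T3)),
      P N {z | (Φ N).flow t z ∈ A} ≤ (Φ N).lawAt (P N) t A := fun N A => by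
    rw [HardSphereFlow.lawAt_eq]
    exact Measure.le_map_apply ((Φ N).measurable_flow t).aemeasurable A
  have key : ∀ A : ∀ N : ℕ, Set (Config (n N) (Fin 3) T3),
      (∀ N : ℕ, Q N (A N) ≤ ENNReal.ofReal (C * Real.exp (-(C⁻¹ * (n N : ℝ))))) →
      Tendsto (fun N : ℕ => P N {z | (Φ N).flow t z ∈ A N}) atTop (𝓝 0) := fun A hA => by
    have h := tendsto_measure_of_klDiv_div_natCast_tendsto_zero (fun N => (Φ N).lawAt (P N) t) Q A
      hn_top hC hA hkl
    exact tendsto_of_tendsto_of_tendsto_of_le_of_le tendsto_const_nhds h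
      (fun N => zero_le) (fun N => htransfer N (A N))
  refine ⟨?_, ?_, ?_⟩
  · exact key (fun N => {z | δ < |empiricalDensityField z χ - ∫ x, χ x * ρ t x|})
      (fun N => (hCN N).1)
  · exact key (fun N => {z | δ < ‖empiricalMomentumField z χ - ∫ x, (χ x * ρ t x) • u t x‖})
      (fun N => (hCN N).2.1)
  · exact key (fun N => {z | δ < |empiricalEnergyField z χ -
        ∫ x, χ x * totalEnergyDensity (ρ t x) (u t x) (θ t x)|}) (fun N => (hCN N).2.2)

end Summit.AtomisticToContinuum.HydrodynamicLimit.Theorems.NearConstantShortTimeHL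

end
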